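import Summits.QuantumFields.YangMills.Theorems.UnitScaleTiltProp7DivRecoveryPatchRowsCore
import Summits.QuantumFields.YangMills.Theorems.UnitScaleTiltProp7TiledCubeMemberH7H8Peeled
import Summits.QuantumFields.YangMills.Theorems.UnitScaleTiltProp7TiledCubeMemberH7H8PeeledIndex
import Summits.QuantumFields.YangMills.Theorems.UnitScaleTiltProp7TiledCubeMemberH7H8PeeledBudget
import Summits.QuantumFields.YangMills.Theorems.UnitScaleTiltProp7Lane2BoxPlateauPeel
import HarnessLib

/-!
# Route `UnitScaleTilt`, crux K1 «MinimiserStabilityRegPr» (stmt-QuantumFields-19200), LANE II «DIVERGENCE RECOVERY AT CURVED `W`» (★★OWNER RULING №23), [I-9]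
# PATCHES1 (★p1 g20 14:15:13Z: wrapper pen → px9 g8): **ONE PATCH — THE NINE ROWS OF `hP1` (hloc, hDφ, the seven budget outputs) FROM CORE ⊕ h7∕h8 ⊕ THE BUDGET**

Cell `ym3-torus`, width seat `ym3-torus-px9` (gen 8).  THEOREMS ONLY (0 `def`, 0 `sorry`); `--supports stmt-QuantumFields-19200 --as helper`; count-neutral.
YM₃ on T³ is a ladder rung (R3) — NOT d = 4, NOT infinite volume, NOT a mass gap, NOT Clay; nothing here claims `hP1`∕`hPatch`∕(REC)∕`hN06`∕EX∕the crux.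

WHAT IS PROVED.  ★★★`patch_rows_one`: in the binders of w1-19200 g16's ⧗`patch_rows_core` (one patch of the regular member: corner centre `c` of block `C`,
record chart box `(basePt, z_c, R_f)`, family cutoff `(Z, ζ, ZE)` with the package rows, (QH1)♮ `hQ` and ✓`coarseGrad_rows_on_inner` `hrow9` at this member,
`hboxS`, `T hT`, curl reading `hCurl` at `Cu`) plus the (a′) h7∕h8 inputs (`hL hF he4 hsm hR5 hCT hTU1 hclose` for `T := descendToGL …`) and the domination
`hCuW` of the box curl letter by `Cu`: THERE EXIST `φ κs r` with `hloc`, `hDφ` and the SEVEN per-patch bounds of px12's `hP1` (✓p724687 :70–:110) —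
`‖φ‖² ≤ cΦ·R²·N_T`, `‖r‖² ≤ …`, `‖Z κs‖² ≤ …`, `L ≤ cL·R⁻²·N_T`, `M ≤ cMAs·As_S + cMCu·Cu + (cMR·R⁻² + cMe·e)·N_T`, `Hρ ≤ …`, `HM ≤ cHM·R⁻²·N_T` — with the
COEFFICIENTS WRITTEN OUT (✓`patch_budget_v2`'s outputs at `CΦ = 576`, `C8 = 13824A²`, `CF = 1944Cc`, `CF′ = 20155392A²`, `Cζ = 972`, `CM = 27∕4`, `CH = 4536`,
`CP = 1106568 + 87360·576` (px9 §5, peel `p = 5`), `C9 = 672`, `C9′ = 7648598016A² + 4032((2CT+29568)² + 29484²)`, `CW = 24 + 432A² + 108`, `B BC BK Ct` of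
✓`currency_h9`), `N := N_T`, `As := As_S` over the PEELED image set `ι(C(B′ − (2L^s+1) + 5, 4L^s − 8))` (its plateau margin `hSC` discharged here by ✓px9 6c §1 ▸
✓w1 `dist_add_three_le_of_cycDist_cornerBlock`), `R := (F.L:ℝ)^s`.  Proof = `patch_rows_core` ▸ `peeled_tiled`∕`h7h8_member_peeled`∕`record_radii_real`∕
`layer_ratio_eq`∕`currency_h7h8_peeled` (px9's E2E p = 5 script) ▸ two monotone weakenings (`CuW ≤ Cu`) ▸ `patch_budget_v2` ▸ `‖Z κs‖² ≤ K` ∘ output (3).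
NOT HERE: the three resource feeds and the quantifier wrapper to `hP1` (next file, px4 g9's `…PatchFeeds`).

References: T. Bałaban, CMP **99** (1985) 389–434 [Balaban1985BackgroundPropagators] ((3.19)-(3.26) pp.393-395, (3.100) pp.413-414); CMP **98** (1985) 17–51
[Balaban1985Averaging] (pp.24-25).
-/

set_option autoImplicit false

noncomputable section

open scoped InnerProductSpace Matrix.Norms.L2Operator BigOperators

namespace Summit.QuantumFields.YangMills.Theorems.Prop7DivRecoveryPatchRowsOne

open Literature.MathematicalPhysics.QuantumFieldTheory.Balaban1983to89
open Literature.MathematicalPhysics.QuantumFieldTheory.Balaban1983to89.T3ContinuumYM3Torus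
open B11Eq103H1Complex (SiteL2K BondL2K)
open B10Eq27TorusAxialLog (transl unitsField toUField)
open B4Eq19LatticeOperators (Zd box unitVec)
open B7Eq78Linearization (conjR)
open B7Prop1Explicit (axialFn)
open B9TorusCalculus (torusT)
open B9Eq39Adjoint (curl)
open B9Eq311L2Pairing (WL2)
open B5Eq118OneStroke (iterBlockOf)
open T3SectALandauChart (eta eta_pos bgUnits)
open Summit.QuantumFields.YangMills.Theorems.Prop7SymAvgGL (descendToGL)
open Summit.QuantumFields.YangMills.Theorems.Prop7QprimeCombL2 (QprimeCombL2)
open Summit.QuantumFields.YangMills.Theorems.Prop7DivRecoveryCurrencyH9 (currency_h9)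
open T3PrintedRegularMinimiser (RegPr)
open T3PrintedRegularOrbits (sites_eq)
open T3LevelShift (bondShift)
open Summit.QuantumFields.YangMills.Theorems.Prop7SectET3Transport (periodsT3)
open Summit.QuantumFields.YangMills.Theorems.Prop7SectET3HilbertLetters (W₂ frobEquiv toL2 toL2S DL2 DstarL2 covLapSite)
open Summit.QuantumFields.YangMills.Theorems.Prop7SectET3CombLetters (Qkc)
open Summit.QuantumFields.YangMills.Theorems.Prop7SPrint (basePt)
open Summit.QuantumFields.YangMills.Theorems.Prop7BoxLocalResidualMember (boxLocalResidual_member)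
open Summit.QuantumFields.YangMills.Theorems.Prop7BoxLocalPotentialCutoffH1 (cutoffH1_member)
open Summit.QuantumFields.YangMills.Theorems.Prop7DivRecoveryPatchAlphaRows (patch_alpha_rows)
open Summit.QuantumFields.YangMills.Theorems.Prop7DivRecoveryCutoffReadings (eta_mul_level patch_hDφ norm_sq_bondCutoff_le_norm_sq)
open Summit.QuantumFields.YangMills.Theorems.Prop7DivRecoveryAssemblyBudgetW4 (currency_h10)
open Summit.QuantumFields.YangMills.Theorems.Prop7Lane2BoxPlateauCutoff (exists_boxPlateauCutoff boxPlateau_eq_one_on_readSet boxPlateau_eq_zero_off_box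
  exists_mem_box_bond_of_boxPlateau_ne_zero)
open Summit.QuantumFields.YangMills.Theorems.Prop7QkcInnerPatchRows (sum_fibre_Qkc_DL2_le_on_inner)
open Summit.QuantumFields.YangMills.Theorems.Prop7Lane2SupportInChart (exists_mem_blockBox_of_dist_lt)
open Summit.QuantumFields.YangMills.Theorems.Prop7Lane2PatchCommutatorH1 (cellConst_of_support)
open Summit.QuantumFields.YangMills.Theorems.Prop7Lane2PatchCommutatorCubes (cycCube_closure mem_cycCube_filter localGrad_le_chartEnergy
  norm_sq_gradComm_le_of_le norm_sq_lapComm_le_of_le localEnergy_gradComm_le_of_le)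
open Summit.QuantumFields.YangMills.Theorems.Prop7TiledCubeMemberH7H8 (sum_le_boxSum_of_chart)
open Summit.QuantumFields.YangMills.Theorems.Prop7LaplaceAFlatLetters (norm_sq_toL2S)
open B4Eq19LatticeOperators (box_mono add_unitVec_mem_box)
open Literature.MathematicalPhysics.QuantumLattice (blockBase)
open B10Eq27TorusAxialLog (holT)
open B7Prop1Explicit (U1 e)
open B7Prop2Explicit (C0 c2')
open T4TermwiseTorus (tlift)
open Summit.QuantumFields.YangMills.Theorems.Prop7Lane2SupportInChart (blockBox_tiled two_mul_recordRadius_add_one_le)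
open Summit.QuantumFields.YangMills.Theorems.Prop7TiledCubeMemberH7H8PeeledA (peeled_tiled)
open Summit.QuantumFields.YangMills.Theorems.Prop7TiledCubeMemberH7H8Peeled (h7h8_member_peeled)
open Summit.QuantumFields.YangMills.Theorems.Prop7TiledCubeMemberH7H8PeeledIndex (layer_ratio_eq record_radii_real cycDist_src_le_of_mem_image)
open Summit.QuantumFields.YangMills.Theorems.Prop7DivRecoveryAssemblyBudgetW4 (patch_budget_v2)
open Summit.QuantumFields.YangMills.Theorems.Prop7TiledCubeMemberH7H8Currency (currency_h7h8_peeled)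

open Summit.QuantumFields.YangMills.Theorems.Prop7DivRecoveryPatchRowsCore (patch_rows_core)
open Summit.QuantumFields.YangMills.Theorems.Prop7TiledCubeMemberH7H8PeeledBudget (h7h8_budget_rows)

set_option maxHeartbeats 400000 in
-- hb: one `obtain` of the 17-row CORE, the (a′) chain, `patch_budget_v2` with thirty written-out letters and a 12-conjunct anonymous constructor — whnf-heavy by size, not by search
/-- ★★★ **[I-9] PATCHES1 — ONE PATCH: `hloc`, `hDφ` AND THE SEVEN BUDGET OUTPUTS OF `hP1`, COEFFICIENTS WRITTEN OUT.** See the module docstring. [cite: Balaban1985BackgroundPropagators, (3.19)-(3.26) pp.393-395, (3.100) pp.413-414] -/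
theorem patch_rows_one (F : T3Family) (n K s : ℕ) (hnK : n < K) (c₀ cB : ℝ) [hc0 : Fact (0 < c₀)] [Fact (0 < cB)]
    (W : GaugeField (F.P K) 0 (Matrix.specialUnitaryGroup (Fin 2) ℂ))
    (C : Site (F.P K) (K - n)) (c : Site (F.P K) 0)
    (hc : ∀ κ : Fin 3, c κ = (((C κ).val * F.L ^ (K - n) : ℕ) : ZMod ((F.P K).sitesPerDir 0)))
    (z : Zd (F.P K).d) (R : ℤ)
    (hz : z = fun κ : Fin (F.P K).d => ((F.L ^ (K - n) : ℕ) : ℤ) *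
          (((((c κ).val : ℕ) : ℤ) - ((((basePt F n K) κ).val : ℕ) : ℤ)) / ((F.L ^ (K - n) : ℕ) : ℤ)) + (((F.L ^ (K - n) : ℕ) : ℤ) - 1) / 2)
    (hRdef : R = (2 * ((F.L ^ s : ℕ) : ℤ) + 1) * ((F.L ^ (K - n) : ℕ) : ℤ) + (((F.L ^ (K - n) : ℕ) : ℤ) - 1) / 2)
    (hR : 0 ≤ R) (hR1 : 1 ≤ R) (hRN : 2 * R + 1 ≤ ((F.P K).sitesPerDir 0 : ℤ))
    (hRf : (R : ℝ) ≤ 4 * (F.L : ℝ) ^ s * (F.L : ℝ) ^ (K - n)) (hinj : Set.InjOn (transl (basePt F n K)) ↑(box z R))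
    (V : Zd (F.P K).d → Fin (F.P K).d → (Matrix (Fin 2) (Fin 2) ℂ)ˣ) (hV : ∀ w μ, V w μ = unitsField (toUField W) ⟨transl (basePt F n K) w, μ⟩)
    {α A e : ℝ} (hα : 0 ≤ α) (hαe : α ≤ A * e * eta F n K ^ 2)
    (he0 : 0 < e) (hw9 : 10 ^ 9 * (F.L : ℝ) ^ 3 * e ≤ 1) (hreg : RegPr F n K e W)
    (hP : B8Lemma1NonAbelian.PlaqSmall V (fun i => z i - R) (fun i => z i + R) α)
    (hw : 64 * ((F.P K).d : ℝ) ^ 3 * 2 * R ^ 3 * (2 * R + 1) * α ^ 2 ≤ 1)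
    (hw4 : 832 * ((F.P K).d : ℝ) ^ 3 * (2 * R + 1) ^ 2 * R ^ 2 * α ^ 2 ≤ 1)
    (y : BondL2K ℂ 3 (periodsT3 F K) c₀ W₂)
    {Cc Cu : ℝ} (hCc : 0 ≤ Cc) (hCu : 0 ≤ Cu)
    (hCurl : c₀ * ∑ w ∈ box z R, ∑ μ, ∑ ν, (if w + unitVec μ + unitVec ν ∈ box z R then
              ∑ j : Fin 2, ∑ k : Fin 2, ‖((toL2 F K c₀).symm y ⟨transl (basePt F n K) w, μ⟩
                + conjR (V w μ) ((toL2 F K c₀).symm y ⟨transl (basePt F n K) (w + unitVec μ), ν⟩)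
                - conjR (V w ν) ((toL2 F K c₀).symm y ⟨transl (basePt F n K) (w + unitVec ν), μ⟩)
                - (toL2 F K c₀).symm y ⟨transl (basePt F n K) w, ν⟩) j k‖ ^ 2 else 0)
          ≤ Cc * ((F.L : ℝ) ^ (K - n))⁻¹ ^ 2 * Cu)
    -- the family cutoff of the patch (ζ_g): ✓`exists_cutoffPackage_grid`'s per-centre rows VERBATIM at `c`
    (Z : SiteL2K ℂ 3 (periodsT3 F K) c₀ W₂ →ₗ[ℂ] SiteL2K ℂ 3 (periodsT3 F K) c₀ W₂) (ζ : Site (F.P K) 0 → ℝ)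
    (ZE : BondL2K ℂ 3 (periodsT3 F K) c₀ W₂ →ₗ[ℂ] BondL2K ℂ 3 (periodsT3 F K) c₀ W₂)
    (h01 : ∀ x, 0 ≤ ζ x ∧ ζ x ≤ 1)
    (hsuppζ : ∀ x : Site (F.P K) 0, ζ x ≠ 0 → ∀ κ : Fin 3, min (x κ - c κ).val (c κ - x κ).val < F.L ^ s * F.L ^ (K - n))
    (hstepζ : ∀ (x : Site (F.P K) 0) (μ : Fin 3), |ζ (x.shift μ) - ζ x| ≤ 3 / 2 / ((F.L : ℝ) ^ s * (F.L : ℝ) ^ (K - n)) ∧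
      |ζ (x.unshift μ) - ζ x| ≤ 3 / 2 / ((F.L : ℝ) ^ s * (F.L : ℝ) ^ (K - n)))
    (hsecζ : ∀ (x : Site (F.P K) 0) (μ : Fin 3), |ζ (x.shift μ) + ζ (x.unshift μ) - 2 * ζ x| ≤ 6 / ((F.L : ℝ) ^ s * (F.L : ℝ) ^ (K - n)) ^ 2)
    (hZ : ∀ φ x, (toL2S F K c₀).symm (Z φ) x = ζ x • (toL2S F K c₀).symm φ x)
    (hZE : ∀ f b, (toL2 F K c₀).symm (ZE f) b = ζ b.src • (toL2 F K c₀).symm f b)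
    (hew : e * ((F.L : ℝ) ^ s) ^ 2 ≤ 1) (hℓ4 : 4 ≤ F.L ^ s * F.L ^ (K - n))
    -- the peeled box mass dominates the transition cube's mass (px9 6c §4 ▸ ✓`sum_le_boxSum_of_chart`, p-generic re-cut ≈ 14:05Z), universal in the field
    (hboxS : ∀ φ' : SiteL2K ℂ 3 (periodsT3 F K) c₀ W₂,
      c₀ * ∑ x ∈ (Finset.univ.filter fun y : Site (F.P K) 0 => ∀ κ : Fin 3, min (y κ - c κ).val (c κ - y κ).val < F.L ^ s * F.L ^ (K - n) + 2),
        ∑ j : Fin 2, ∑ k : Fin 2, ‖((toL2S F K c₀).symm φ' x) j k‖ ^ 2 ≤ c₀ * ∑ w ∈ box z (R - ((5 : ℕ) : ℤ) * ((F.L ^ (K - n) : ℕ) : ℤ)), ∑ j : Fin 2, ∑ k : Fin 2, ‖((toL2S F K c₀).symm φ' (transl (basePt F n K) w)) j k‖ ^ 2)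
    (T : Finset (PBond (F.P K) 0))
    (hT : ∀ w ∈ box z R, ∀ μ, w + unitVec μ ∈ box z R → (⟨transl (basePt F n K) w, μ⟩ : PBond (F.P K) 0) ∈ T)
    -- (QH1)♮ AT THIS MEMBER (EX-displayed row `hQH1` instantiated; door functional written out), universal in `f`
    {Bq Bq' Bq'' : ℝ} (hBq : 0 ≤ Bq) (hBq' : 0 ≤ Bq') (hBq'' : 0 ≤ Bq'') (he1 : e ≤ 1)
    (hQ : ∀ f : BondL2K ℂ 3 (periodsT3 F K) c₀ W₂,
      c₀ / cB * ((F.L : ℝ) ^ (K - n)) ^ 3 * ‖Qkc F n K hnK.le c₀ cB W f‖ ^ 2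
        ≤ Bq * ‖f‖ ^ 2
          + Bq' * (c₀ * ((F.L : ℝ) ^ (K - n)) ^ 2 * (∑ x : Site (F.P K) 0, ∑ μ : Fin (F.P K).d, ∑ ν' : Fin (F.P K).d,
              (if μ < ν' then ∑ j : Fin 2, ∑ k : Fin 2,
                ‖(curl (torusT (F.P K) 0) (fun κ x => unitsField (toUField W) ⟨x, κ⟩) (fun κ x => (toL2 F K c₀).symm f ⟨x, κ⟩) μ ν' x) j k‖ ^ 2 else 0))
              + ‖DstarL2 F n K c₀ W f‖ ^ 2)
          + Bq'' * e * ‖f‖ ^ 2)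
    -- ✓`coarseGrad_rows_on_inner` AT THIS MEMBER (its `C3` obtained at the top of `patch_rows`), universal in the cutoff and the fields
    {C3 : ℝ}
    (hrow9 : ∀ (ζ' : Site (F.P K) 0 → ℝ) (Zb : BondL2K ℂ 3 (periodsT3 F K) c₀ W₂ →ₗ[ℂ] BondL2K ℂ 3 (periodsT3 F K) c₀ W₂),
      (∀ (f : BondL2K ℂ 3 (periodsT3 F K) c₀ W₂) (b : PBond (F.P K) 0), (toL2 F K c₀).symm (Zb f) b = ζ' b.src • (toL2 F K c₀).symm f b) →
      ∀ (S' : Finset (PBond (F.P K) (K - n))),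
        (∀ chat ∈ S', ∀ x : Site (F.P K) 0,
          (∀ κ : Fin (F.P K).d, min ((iterBlockOf (K - n) x) κ - chat.src κ).val (chat.src κ - (iterBlockOf (K - n) x) κ).val ≤ 2) → ζ' x = 1) →
        ∀ (φ' : SiteL2K ℂ 3 (periodsT3 F K) c₀ W₂) (y' r' : BondL2K ℂ 3 (periodsT3 F K) c₀ W₂),
          Zb (DL2 F n K c₀ W φ') = Zb y' - Zb r' →
          cB * ∑ c ∈ S', ‖conjR (descendToGL F n K hnK.le (bgUnits F K W) ((bondShift (sites_eq F n K hnK.le)).symm c))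
              (QprimeCombL2 F n K c₀ W φ' (c.src.shift c.dir)) - QprimeCombL2 F n K c₀ W φ' c.src‖ ^ 2
            ≤ 4 * (cB * ∑ c ∈ S', ‖WL2.equiv ℂ (fun _ : PBond (F.P n) 0 => cB) W₂
                  (Qkc F n K hnK.le c₀ cB W y') ((bondShift (sites_eq F n K hnK.le)).symm c)‖ ^ 2)
              + 4 * ‖Qkc F n K hnK.le c₀ cB W (Zb r')‖ ^ 2
              + C3 * e ^ 2 * ((((F.L : ℝ) ^ (K - n)) ^ 3)⁻¹ * ‖φ'‖ ^ 2))
    -- (a′) h7∕h8 inputs: the px5 window, (B3c) rider for `T := descendToGL …`, the peel room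
    {L : ℕ} (hL : 1 < L) (hF : F.L = L) (he4 : e ≤ min (6 * C0 3)⁻¹ (c2' 3 L / 4)) (hsm : s < F.m + n) (hR5 : 5 ≤ F.L ^ s)
    {CT : ℝ} (hCT : 0 ≤ CT)
    (hTU1 : ∀ ĉ : PBond (F.P K) (K - n), descendToGL F n K hnK.le (bgUnits F K W) ((bondShift (sites_eq F n K hnK.le)).symm ĉ) ∈ U1 (Matrix (Fin 2) (Fin 2) ℂ))
    (hclose : ∀ ĉ : PBond (F.P K) (K - n),
      ‖((descendToGL F n K hnK.le (bgUnits F K W) ((bondShift (sites_eq F n K hnK.le)).symm ĉ) : (Matrix (Fin 2) (Fin 2) ℂ)ˣ) : Matrix (Fin 2) (Fin 2) ℂ)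
          - ((holT (unitsField (toUField W)) (transl (basePt F n K) (blockBase ((F.P K).L ^ (K - n)) (tlift ĉ.src)))
              (List.replicate ((F.P K).L ^ (K - n)) (ĉ.dir, true)) : (Matrix (Fin 2) (Fin 2) ℂ)ˣ) : Matrix (Fin 2) (Fin 2) ℂ)‖ ≤ CT * e)
    -- the box curl letter of h9∕h10 is dominated by the budget's `Cu` (px4 `feedCuW` at `Cu :=` the site-patch curl sum)
    (hCuW : c₀ * ((F.L : ℝ) ^ (K - n)) ^ 2 * (∑ w ∈ box z R, ∑ μ : Fin (F.P K).d, ∑ ν' : Fin (F.P K).d, (if μ < ν' then ∑ j : Fin 2, ∑ k : Fin 2, ‖(curl (torusT (F.P K) 0) (fun κ x => unitsField (toUField W) ⟨x, κ⟩) (fun κ x => (toL2 F K c₀).symm y ⟨x, κ⟩) μ ν' (transl (basePt F n K) w)) j k‖ ^ 2 else 0)) ≤ Cu)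
    (hC3 : 0 ≤ C3) :
    ∃ (φ κs : SiteL2K ℂ 3 (periodsT3 F K) c₀ W₂) (r : BondL2K ℂ 3 (periodsT3 F K) c₀ W₂),
      Z (DstarL2 F n K c₀ W y) = Z (covLapSite F n K c₀ W φ) + Z κs ∧
      ZE (DL2 F n K c₀ W φ) = ZE y - ZE r ∧
    ‖φ‖ ^ 2 ≤ 576 * ((F.L : ℝ) ^ s) ^ 2 * (c₀ * ∑ b ∈ T, ‖(frobEquiv.symm ((toL2 F K c₀).symm y b) : W₂)‖ ^ 2) ∧
    ‖r‖ ^ 2 ≤ (1944 * Cc) * ((F.L : ℝ) ^ s) ^ 2 * Cu + (20155392 * A ^ 2) * ((F.L : ℝ) ^ s) ^ 4 * e * (c₀ * ∑ b ∈ T, ‖(frobEquiv.symm ((toL2 F K c₀).symm y b) : W₂)‖ ^ 2) ∧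
    ‖Z κs‖ ^ 2 ≤ (13824 * A ^ 2) * (1944 * Cc) * ((F.L : ℝ) ^ s) ^ 4 * Cu + (13824 * A ^ 2) * (20155392 * A ^ 2) * ((F.L : ℝ) ^ s) ^ 6 * e * (c₀ * ∑ b ∈ T, ‖(frobEquiv.symm ((toL2 F K c₀).symm y b) : W₂)‖ ^ 2) ∧
    ‖covLapSite F n K c₀ W (Z φ) - Z (covLapSite F n K c₀ W φ)‖ ^ 2 ≤ 972 * (1 + 576) * ((F.L : ℝ) ^ s)⁻¹ ^ 2 * (c₀ * ∑ b ∈ T, ‖(frobEquiv.symm ((toL2 F K c₀).symm y b) : W₂)‖ ^ 2) ∧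
    ‖DL2 F n K c₀ W (Z φ) - ZE (DL2 F n K c₀ W φ)‖ ^ 2 ≤ 4 * (27 / 4) * 672 * (c₀ / cB * ((F.L : ℝ) ^ (K - n)) ^ 3 * (cB * ∑ c ∈ (((Fintype.piFinset (fun i => Finset.Icc ((fun i : Fin (F.P K).d => ((((((c i).val : ℕ) : ℤ) - ((((basePt F n K) i).val : ℕ) : ℤ)) / ((F.L ^ (K - n) : ℕ) : ℤ) - (2 * ((F.L ^ s : ℕ) : ℤ) + 1)) + ((5 : ℕ) : ℤ))) i) ((fun i : Fin (F.P K).d => ((((((c i).val : ℕ) : ℤ) - ((((basePt F n K) i).val : ℕ) : ℤ)) / ((F.L ^ (K - n) : ℕ) : ℤ) - (2 * ((F.L ^ s : ℕ) : ℤ) + 1)) + ((5 : ℕ) : ℤ))) i + ((4 * F.L ^ s + 2 - 2 * 5 : ℕ) : ℤ)))) ×ˢ (Finset.univ : Finset (Fin (F.P K).d))).filter (fun q => q.1 + B7Prop1Explicit.e q.2 ∈ Fintype.piFinset (fun i => Finset.Icc ((fun i : Fin (F.P K).d => ((((((c i).val : ℕ) : ℤ) - ((((basePt F n K) i).val : ℕ)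 : ℤ)) / ((F.L ^ (K - n) : ℕ) : ℤ) - (2 * ((F.L ^ s : ℕ) : ℤ) + 1)) + ((5 : ℕ) : ℤ))) i) ((fun i : Fin (F.P K).d => ((((((c i).val : ℕ) : ℤ) - ((((basePt F n K) i).val : ℕ) : ℤ)) / ((F.L ^ (K - n) : ℕ) : ℤ) - (2 * ((F.L ^ s : ℕ) : ℤ) + 1)) + ((5 : ℕ) : ℤ))) i + ((4 * F.L ^ s + 2 - 2 * 5 : ℕ) : ℤ))))).image (fun q => (⟨transl (0 : Site (F.P K) (K - n)) q.1, q.2⟩ : PBond (F.P K) (K - n))), ‖WL2.equiv ℂ (fun _ : PBond (F.P n) 0 => cB) W₂ (Qkc F n K hnK.le c₀ cB W y) ((bondShift (sites_eq F n K hnK.le)).symm c)‖ ^ 2)) + (27 / 4) * 672 * (((4 * (Bq + Bq'') + 4 * Bq' * (24 + 432 * A ^ 2 + 48 * (2 * (F.L : ℝ) ^ s) ^ 2) * ((F.L : ℝ) ^ s)⁻¹ ^ 2) + (4 * Bq' * (24 + 432 * A ^ 2 + 48 * (2 * (F.L : ℝ) ^ s) ^ 2)) * (13824 * A ^ 2)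 * ((F.L : ℝ) ^ s) ^ 2) * (1944 * Cc) * ((F.L : ℝ) ^ s) ^ 2 + (4 * Bq' * (24 + 432 * A ^ 2 + 48 * (2 * (F.L : ℝ) ^ s) ^ 2))) * Cu
        + ((27 / 4) * (1106568 + 87360 * 576) * ((F.L : ℝ) ^ s)⁻¹ ^ 2
            + ((27 / 4) * (1106568 + 87360 * 576) * 576 + (27 / 4) * 672 * (4 * Bq' * (24 + 432 * A ^ 2 + 48 * (2 * (F.L : ℝ) ^ s) ^ 2) + C3 * (c₀ / cB)) * 576 * ((F.L : ℝ) ^ s) ^ 2 + (27 / 4) * (7648598016 * A ^ 2 + 4032 * ((2 * CT + 29568) ^ 2 + 29484 ^ 2)) * 576 * ((F.L : ℝ) ^ s) ^ 4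
                + (27 / 4) * 672 * ((4 * (Bq + Bq'') + 4 * Bq' * (24 + 432 * A ^ 2 + 48 * (2 * (F.L : ℝ) ^ s) ^ 2) * ((F.L : ℝ) ^ s)⁻¹ ^ 2) + (4 * Bq' * (24 + 432 * A ^ 2 + 48 * (2 * (F.L : ℝ) ^ s) ^ 2)) * (13824 * A ^ 2) * ((F.L : ℝ) ^ s) ^ 2) * (20155392 * A ^ 2) * ((F.L : ℝ) ^ s) ^ 4) * e) * (c₀ * ∑ b ∈ T, ‖(frobEquiv.symm ((toL2 F K c₀).symm y b) : W₂)‖ ^ 2) ∧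
    (c₀ * ((F.L : ℝ) ^ (K - n)) ^ 2 * (∑ x : Site (F.P K) 0, ∑ μ : Fin (F.P K).d, ∑ ν' : Fin (F.P K).d, (if μ < ν' then ∑ j : Fin 2, ∑ k : Fin 2, ‖(curl (torusT (F.P K) 0) (fun κ x => unitsField (toUField W) ⟨x, κ⟩) (fun κ x => (toL2 F K c₀).symm (ZE r) ⟨x, κ⟩) μ ν' x) j k‖ ^ 2 else 0)) + ‖DstarL2 F n K c₀ W (ZE r)‖ ^ 2) ≤ (24 + 432 * A ^ 2 + 48 * (3 / 2) ^ 2) * (1 + (1944 * Cc) + (13824 * A ^ 2) * (1944 * Cc) * ((F.L : ℝ) ^ s) ^ 4) * Cu + (24 + 432 * A ^ 2 + 48 * (3 / 2) ^ 2) * (576 * ((F.L : ℝ) ^ s) ^ 2 + (20155392 * A ^ 2) * ((F.L : ℝ) ^ s) ^ 2 + (13824 * A ^ 2) * (20155392 * A ^ 2) * ((F.L : ℝ) ^ s) ^ 6) * e * (c₀ * ∑ b ∈ T, ‖(frobEquiv.symm ((toL2 F K c₀).symm y b) : W₂)‖ ^ 2) ∧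
    (c₀ * ((F.L : ℝ) ^ (K - n)) ^ 2 * (∑ x : Site (F.P K) 0, ∑ μ : Fin (F.P K).d, ∑ ν' : Fin (F.P K).d, (if μ < ν' then ∑ j : Fin 2, ∑ k : Fin 2, ‖(curl (torusT (F.P K) 0) (fun κ x => unitsField (toUField W) ⟨x, κ⟩) (fun κ x => (toL2 F K c₀).symm (DL2 F n K c₀ W (Z φ) - ZE (DL2 F n K c₀ W φ)) ⟨x, κ⟩) μ ν' x) j k‖ ^ 2 else 0)) + ‖DstarL2 F n K c₀ W (DL2 F n K c₀ W (Z φ) - ZE (DL2 F n K c₀ W φ))‖ ^ 2) ≤ 4536 * (1 + 576) * ((F.L : ℝ) ^ s)⁻¹ ^ 2 * (c₀ * ∑ b ∈ T, ‖(frobEquiv.symm ((toL2 F K c₀).symm y b) : W₂)‖ ^ 2) := by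
  subst hz hRdef
  have hL0 : 0 < F.L := by have := F.hL.2; omega
  have hd : (F.P K).d = 3 := T3Family.P_d F K
  have hℓη : eta F n K * (F.L : ℝ) ^ (K - n) = 1 := eta_mul_level F K n
  have hℓ : 0 < (F.L : ℝ) ^ (K - n) := pow_pos (by exact_mod_cast hL0) _
  have hR₀ : 0 < (F.L : ℝ) ^ s := pow_pos (by exact_mod_cast hL0) _
  have hR2 : 2 ≤ F.L ^ s := le_trans (by norm_num) hR5
  -- ### the peeled index set satisfies the box-plateau margin (px9 6c §1 ▸ w1 LINK)
  have hblk := Summit.QuantumFields.YangMills.Theorems.Prop7Lane2BoxPlateauPeel.cornerBlock_eq F n K C c hc hnK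
  have hSC : ∀ chat ∈ (((Fintype.piFinset (fun i => Finset.Icc ((fun i : Fin (F.P K).d => ((((((c i).val : ℕ) : ℤ) - ((((basePt F n K) i).val : ℕ) : ℤ)) / ((F.L ^ (K - n) : ℕ) : ℤ) - (2 * ((F.L ^ s : ℕ) : ℤ) + 1)) + ((5 : ℕ) : ℤ))) i) ((fun i : Fin (F.P K).d => ((((((c i).val : ℕ) : ℤ) - ((((basePt F n K) i).val : ℕ) : ℤ)) / ((F.L ^ (K - n) : ℕ) : ℤ) - (2 * ((F.L ^ s : ℕ) : ℤ) + 1)) + ((5 : ℕ) : ℤ))) i + ((4 * F.L ^ s + 2 - 2 * 5 : ℕ) : ℤ)))) ×ˢ (Finset.univ : Finset (Fin (F.P K).d))).filter (fun q => q.1 + B7Prop1Explicit.e q.2 ∈ Fintype.piFinset (fun i => Finset.Icc ((fun i : Fin (F.P K).d => ((((((c i).val : ℕ) : ℤ) - ((((basePt F n K) i).val : ℕ) : ℤ)) / ((F.L ^ (K - n) : ℕ) : ℤ) - (2 * ((F.L ^ s : ℕ) : ℤ) + 1)) + ((5 : ℕ) : ℤ))) i) ((fun i : Fin (F.P K).d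 => ((((((c i).val : ℕ) : ℤ) - ((((basePt F n K) i).val : ℕ) : ℤ)) / ((F.L ^ (K - n) : ℕ) : ℤ) - (2 * ((F.L ^ s : ℕ) : ℤ) + 1)) + ((5 : ℕ) : ℤ))) i + ((4 * F.L ^ s + 2 - 2 * 5 : ℕ) : ℤ))))).image (fun q => (⟨transl (0 : Site (F.P K) (K - n)) q.1, q.2⟩ : PBond (F.P K) (K - n))),
      ∀ κ : Fin 3, min (chat.src κ - C κ).val (C κ - chat.src κ).val + 3 ≤ 2 * F.L ^ s := by
    intro chat hchat
    refine Summit.QuantumFields.YangMills.Theorems.Prop7Lane2BoxPlateauPeel.dist_add_three_le_of_cycDist_cornerBlock F n K s C c hc hnK (2 * F.L ^ s - 3) (by omega) chat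
      (cycDist_src_le_of_mem_image F n K _
        (fun κ => (((((c κ).val : ℕ) : ℤ) - ((((basePt F n K) κ).val : ℕ) : ℤ)) / ((F.L ^ (K - n) : ℕ) : ℤ) + 1)) _ (2 * F.L ^ s - 3)
        (fun κ => ?_) (fun κ => ?_) chat hchat)
    · have := hblk κ; simp only [this]; omega
    · have := hblk κ; simp only [this]; omega
  -- ### CORE: the seventeen per-patch rows by name (w1-19200 g16 ⧗p724377)
  obtain ⟨φ, κs, r, φZ, hS1b, h0, hlocZ, hDφ, hGN, hΦ, hK, hρ, h5, h6, h11, h10ζ, h9⟩ :=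
    patch_rows_core F n K s hnK c₀ cB W C c hc _ _ rfl rfl hR hR1 hRN hRf hinj V hV hα hαe he0 hw9 hreg hP hw hw4 y hCc hCu hCurl
      Z ζ ZE h01 hsuppζ hstepζ hsecζ hZ hZE hew hℓ4 hboxS T hT hBq hBq' hBq'' he1 hQ hrow9 _ hSC
  -- ### h7∕h8 in budget currency by ONE call (px9 FILE 6d `h7h8_budget_rows`, the E2E p = 5 certificate as a theorem)
  have hR4 : 4 ≤ F.L ^ s := le_trans (by norm_num) hR5
  have hc0pos : 0 < c₀ := hc0.out
  obtain ⟨Φt', Nt, Gc', hΦt, hGc, h7, h8⟩ := h7h8_budget_rows F n K s c₀ hnK.le hsm hR4 hL hF he0 he4 W hreg hCT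
    (fun ĉ => descendToGL F n K hnK.le (bgUnits F K W) ((bondShift (sites_eq F n K hnK.le)).symm ĉ)) hTU1 hclose
    (fun κ : Fin (F.P K).d => (((((c κ).val : ℕ) : ℤ) - ((((basePt F n K) κ).val : ℕ) : ℤ)) / ((F.L ^ (K - n) : ℕ) : ℤ)))
    V hV hα hαe hP φ φZ hS1b h0 (CΦ := 576) (by norm_num) hGN hΦ
  subst hΦt hGc
  -- ### the box curl letter is dominated by `Cu` (two monotone weakenings)
  have hCW0 : (0 : ℝ) ≤ 24 + 432 * A ^ 2 + 48 * (3 / 2) ^ 2 := by positivity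
  have hCWχ0 : (0 : ℝ) ≤ 4 * Bq' * (24 + 432 * A ^ 2 + 48 * (2 * (F.L : ℝ) ^ s) ^ 2) := by positivity
  have h10' := h10ζ.trans (mul_le_mul_of_nonneg_left (add_le_add (add_le_add (add_le_add hCuW le_rfl) le_rfl) le_rfl) hCW0)
  have hmono := mul_le_mul_of_nonneg_left hCuW hCWχ0
  have h9' := h9.trans (add_le_add (add_le_add (add_le_add le_rfl hmono) le_rfl) le_rfl)
  -- ### the budget (★p1 g19 ✓p713712 `patch_budget_v2`) at the canonical letters
  have hcB0 : 0 < cB := Fact.out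
  have hN0 : 0 ≤ (c₀ * ∑ b ∈ T, ‖(frobEquiv.symm ((toL2 F K c₀).symm y b) : W₂)‖ ^ 2) :=
    mul_nonneg hc0pos.le (Finset.sum_nonneg fun b _ => by positivity)
  have hR1r : (1 : ℝ) ≤ (F.L : ℝ) ^ s := by exact_mod_cast Nat.one_le_pow _ _ hL0
  have hBq0 : (0 : ℝ) ≤ 4 * (Bq + Bq'') + 4 * Bq' * (24 + 432 * A ^ 2 + 48 * (2 * (F.L : ℝ) ^ s) ^ 2) * ((F.L : ℝ) ^ s)⁻¹ ^ 2 := by positivity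
  have hCt0 : (0 : ℝ) ≤ 4 * Bq' * (24 + 432 * A ^ 2 + 48 * (2 * (F.L : ℝ) ^ s) ^ 2) + C3 * (c₀ / cB) := by positivity
  have hB := patch_budget_v2 (R := (F.L : ℝ) ^ s) (CΦ := 576) (C8 := 13824 * A ^ 2) (CF := 1944 * Cc) (CF' := 20155392 * A ^ 2) (Cζ := 972) (CM := 27 / 4)
    (CH := 4536) (CP := 1106568 + 87360 * 576) (C9 := 672) (C9' := 7648598016 * A ^ 2 + 4032 * ((2 * CT + 29568) ^ 2 + 29484 ^ 2))
    (CW := 24 + 432 * A ^ 2 + 48 * (3 / 2) ^ 2)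
    hN0 hCu (sq_nonneg _) (sq_nonneg _) hR1r he0.le he1 (by norm_num) (by positivity) (by positivity) (by positivity) (by norm_num) (by norm_num)
    (by norm_num) (by norm_num) (by norm_num) (by positivity) hBq0 hCWχ0 hCt0 hCW0
    le_rfl hΦ le_rfl hρ h5 h6 h7 h8 h9' h10' h11
  obtain ⟨hb1, hb2, hb3, hb4, hb5, hb6, hb7⟩ := hB
  exact ⟨φ, κs, r, hlocZ, hDφ, hb1, hb2, hK.trans hb3, hb4, hb5, hb6, hb7⟩

end Summit.QuantumFields.YangMills.Theorems.Prop7DivRecoveryPatchRowsOne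

end
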